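import Summits.HodgeConjecture.HodgeConjecture.Theorems.R90S6TwistedOrbitalIndicatorCount   -- ★ J1′ `epsOrbitalIntegral_indicator_quotientMeasure_eq_mul_ncard_shell` (generic twisted unfolding; R90-C14-p08)
import Summits.HodgeConjecture.HodgeConjecture.Theorems.R90S6TwistedShellLatticeDict        -- ★ J2′ `latt_mul_qsInvolution` (brings ★ L1 `R90S6LatticeInvPolarity` (`qsInvolution_mem_glInt`), ★ W9 `R90S6TwistedPolarity` (W9-e₁), ★ W7-f `glCosetEquivLatt`)
import Summits.HodgeConjecture.HodgeConjecture.Theorems.R90S6DualFixedIffSelfDual            -- ★ W9-e₂ `dualLatt_latt_eq_self_iff_isSelfDualLattice` (R90-C14-p03)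
import Literature.NumberTheory.Automorphic.UnitaryLatticeTreeFrameChange                    -- ★ `isSelfDualLattice_formCongr_iff` (frame change for self-dual lattices)
import HarnessLib

/-!
# R90 · S6 «Ch. 14.1–14.5 stable trace formula» — card K1 (row E1.4.3.3.2, first half): THE UNIT SHELL — THE TWISTED ORBITAL INTEGRAL OF
# `1_{GL_N(𝒪)}` IS `ν(GL_N(𝒪))` TIMES THE NUMBER OF `h_δ`-SELF-DUAL LATTICES (`Theorems/R90S6TwistedUnitSelfDualCount.lean`)

The `a = 0` (unit element of the Hecke algebra) instance of the chain ★ J1′ (`Theorems/R90S6TwistedOrbitalIndicatorCount`, twisted unfolding: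
`Φ_ε(δ, 1_S; ν∕t) = ν(K)·#{q : q.out⁻¹ δ ε(q.out) ∈ S}`) ∘ ★ J2′ (`Theorems/R90S6TwistedShellLatticeDict`, twisted shell ↔ lattices), over a discretely valued field
`K` (`Valued K ℤᵐ⁰` + compatible `ValuativeRel K`; `𝒪 = 𝒪[K]`, `GL_N(𝒪) = glInt N K`), with `J₀ = w⁰ = (StdForm.antidiagonal N).over K`, `Θ_σ = UnitaryGroup.qsInvolution σ`
(`σ` valuation-preserving), the twisting endomorphism being any `ε : GL_N(K) →* GL_N(K)` that agrees with `Θ_σ` pointwise (`hεΘ`; e.g. ★ `Ch4Sec10.unitaryTwist σ w⁰`,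
the S4∕S6 `twistLocal`∕`epsLoc`), and `𝓛 = {M ∕∕ ∃ g, M = g·𝒪^N}` the framed `𝒪`-lattices of `K^N`:

* §1 **`epsOrbitalIntegral_indicator_glInt_eq_mul_ncard_twistedPolarFixed`** — at a COMPACT ε-centraliser of `t`-mass one,
  `Φ_ε(δ, 1_{GL_N(𝒪)}; ν∕t) = ν(GL_N(𝒪)) · #{Λ ∈ 𝓛 : δ·Λ^♯ = Λ}` — the fixed lattices of the twisted polarity `P_δ Λ = δ·Λ^♯` (row E1.4.3.1.2).  Road: J1′ at `S = GL_N(𝒪)`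
  (twisted-`K`-invariant by ★ `qsInvolution_mem_glInt`), then `q.out⁻¹·(δ Θ q.out) ∈ GL_N(𝒪) ⟺ q.out·𝒪^N = (δ Θ q.out)·𝒪^N` (★ W7-f (i) `latt_eq_latt_iff_mem_glInt` — the
  `a = 0` shell needs no uniformizer; it is ★ J2′'s HEAD at `a = 0` by ★ `relPos_self`) `= δ·(q.out·𝒪^N)^♯` (★ J2′ `latt_mul_qsInvolution`), transported along ★ W7-f
  `glCosetEquivLatt`;
* §2 **`setOf_mapGL_dualLatt_eq_self_eq_setOf_isSelfDualLattice`** — `{Λ : δ·Λ^♯ = Λ} = {Λ : Λ is self-dual for h_δ := J₀·δ⁻¹}` (★ W9-e₁ `mapGL_dualLatt_eq_dualLatt_mul_inv`: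
  `δ·Λ^♯ = Λ^{♯, J₀δ⁻¹}`; ★ W9-e₂ `dualLatt_latt_eq_self_iff_isSelfDualLattice`), whence **`epsOrbitalIntegral_indicator_glInt_eq_mul_ncard_isSelfDualLattice`**:
  `Φ_ε(δ, 1_{GL_N(𝒪)}; ν∕t) = ν(GL_N(𝒪)) · #{h_δ-self-dual lattices}` — the lattice side of Kottwitz's unit identity [Kt₁]
  «`TO_{δσ}(1_{K_E}) = #(h_δ-self-dual lattices)·vol = Σ_{γ′ ∼_st γ} O_{γ′}(1_{K})`» ([Kottwitz1986BaseChangeUnits] §1 pp. 239–243);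
* §3 **`ncard_isSelfDualLattice_mul_inv_eq_of_formCongr`** (CONDITIONAL transport): if `h_δ = J₀·δ⁻¹` is the Gram matrix `ᵗ(σg₀) J₀ g₀` of `J₀` in some frame `g₀`
  (`hg₀ : formCongr σ g₀ J₀ = J₀ * ↑δ⁻¹` — its EXISTENCE for ε-symmetric `δ` of trivial norm class is Jacobowitz's one-class theorem + the ★ W9-f∕W9-g descent, NOT proved
  here), then `Λ ↦ g₀·Λ` is a bijection from the `h_δ`-self-dual onto the `J₀`-self-dual (hyperspecial) framed lattices (★ `isSelfDualLattice_formCongr_iff`), so the two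
  counts agree.

Cell `hodgecm-mathlib`, crux H413 (`stmt-HodgeConjecture-24833`), route of record `HCCMUnconditional`; programme R90-TF, section S6 (base `R90-C14`, dealer
R90-C14-plan (g2), card K1 2026-09-05T00:33:50Z), seat R90-C14-p08 (g0).  Lane `--kind proof --supports stmt-HodgeConjecture-24833 --as helper`; THEOREMS ONLY over
★ `Theorems` ∕ Literature carriers (no definition, no instance, no notation, no named fact, no kit, no `sorry`).  The topological ∕ measure mixins on `GL_N(K)` are
BINDERS (as in ★ `R90.S4.IsEpsCanonicalAt`), discharged by the consumer at `G̃_v`.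
HONEST LABEL: corollary + dictionary, count-neutral until E1.4.3.3.2 closes (its second half — matching with the `U`-side stable orbital integrals — is not here);
HC_CM is proved only modulo the 7 printed citations (2 remaining named inputs: hLiu418 = stmt-HodgeConjecture-24832, h413 = stmt-HodgeConjecture-24833) until rung 0 closes.

## References
* [Kottwitz1986BaseChangeUnits] R. E. Kottwitz, *Base change for unit elements of Hecke algebras*, Compositio Math. 60 (1986): §1 pp. 239–243 («`X_L`», the
  twisted fixed points as lattice counts pp. 240–242, (C′); the units matching theorem p. 243), §3 pp. 246–248 (unramified-torus descent — for §3 below only).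
* [Rogawski1990] J. D. Rogawski, *Automorphic Representations of Unitary Groups in Three Variables* (1990): §4.10 (4.10.1) p. 57; §4.11 Prop. 4.11.1 (units).
* [Jacobowitz1962] R. Jacobowitz, *Hermitian forms over local fields*, Amer. J. Math. 84 (1962): §7 (one class of unimodular lattices, unramified).
-/

set_option autoImplicit false
-- the mandated namespace repeats the single-problem summit's segment (`HodgeConjecture.HodgeConjecture`)
set_option linter.dupNamespace false

noncomputable section

open MeasureTheory Measure Topology
open scoped Valued WithZero Matrix MatrixGroups ENNReal Pointwise
open Literature.MeasureTheory.Group Literature.NumberTheory.Automorphic Literature.NumberTheory.Automorphic.HermitianLattice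
  Literature.NumberTheory.Automorphic.UnitaryLatticeTree
open Literature.NumberTheory.Rogawski1990.Ch4Sec10

namespace Summit.HodgeConjecture.HodgeConjecture.R90.S6

/-! ## §1 The unit shell: `Φ_ε(δ, 1_{GL_N(𝒪)}) = ν(GL_N(𝒪)) · #{Λ : δ·Λ^♯ = Λ}` -/

section Unit

variable {K : Type*} [Field K] [Valued K ℤᵐ⁰] [ValuativeRel K] [(Valued.v : Valuation K ℤᵐ⁰).Compatible] {σ : K →+* K} {N : ℕ}

/-- **The unit shell read on lattices**: for `σ` valuation-preserving, `ε` agreeing with `Θ_σ`, and `q ∈ GL_N(K) ⧸ GL_N(𝒪)`,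
`q.out⁻¹ · δ · ε(q.out) ∈ GL_N(𝒪) ⟺ δ·(q.out·𝒪^N)^♯ = q.out·𝒪^N` (★ W7-f (i) `latt_eq_latt_iff_mem_glInt`, ★ J2′ `latt_mul_qsInvolution`; the `a = 0` case of ★ J2′
`inv_mul_mul_qsInvolution_mem_doubleCoset_iff_relPos`, needing no uniformizer). [cite: Kottwitz1986BaseChangeUnits, §1 p. 240] -/
theorem inv_mul_mul_apply_mem_glInt_iff_mapGL_dualLatt_eq (hvσ : ∀ a, Valued.v (σ a) = Valued.v a)
    (ε : GL (Fin N) K →* GL (Fin N) K) (hεΘ : ∀ g, ε g = UnitaryGroup.qsInvolution σ g) (δ : GL (Fin N) K) (q : GL (Fin N) K ⧸ glInt N K) :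
    q.out⁻¹ * δ * ε q.out ∈ (glInt N K : Set (GL (Fin N) K)) ↔
      mapGL δ (dualLatt σ ((StdForm.antidiagonal N).over K) (latt ((q.out : GL (Fin N) K) : Matrix (Fin N) (Fin N) K))) =
        latt ((q.out : GL (Fin N) K) : Matrix (Fin N) (Fin N) K) := by
  rw [SetLike.mem_coe, mul_assoc, ← latt_eq_latt_iff_mem_glInt, hεΘ, latt_mul_qsInvolution hvσ, eq_comm]

variable [LocallyCompactSpace (GL (Fin N) K)] [SecondCountableTopology (GL (Fin N) K)] [T2Space (GL (Fin N) K)]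
  [MeasurableSpace (GL (Fin N) K)] [BorelSpace (GL (Fin N) K)]
  (ε : GL (Fin N) K →* GL (Fin N) K) (δ : GL (Fin N) K)
  [MeasurableSpace (GL (Fin N) K ⧸ epsCentralizer ε δ)] [BorelSpace (GL (Fin N) K ⧸ epsCentralizer ε δ)]
  [hC : IsClosed ((epsCentralizer ε δ : Subgroup (GL (Fin N) K)) : Set (GL (Fin N) K))]
  (t : Measure (epsCentralizer ε δ)) [t.IsMulLeftInvariant]
  [IsFiniteMeasureOnCompacts t] [t.IsOpenPosMeasure] [t.IsInvInvariant] [SFinite t]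
  (ν : Measure (GL (Fin N) K)) [IsHaarMeasure ν] [ν.IsMulRightInvariant]
  [CompactSpace (epsCentralizer ε δ)]

/-- **K1 §1 — THE UNIT SHELL: `Φ_ε(δ, 1_{GL_N(𝒪)}; ν∕t) = ν(GL_N(𝒪)) · #{Λ ∈ 𝓛 : δ·Λ^♯ = Λ}`.**  For `σ` valuation-preserving, a continuous `ε : GL_N(K) →* GL_N(K)` agreeing with
`Θ_σ` (`hεΘ`), `GL_N(𝒪)` open, `δ` with COMPACT ε-centraliser of `t`-mass one, and finitely many framed lattices fixed by the twisted polarity `P_δ Λ = δ·Λ^♯`: the real twisted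
orbital integral (★ `epsOrbitalIntegral`) of `1_{GL_N(𝒪)}` against the invariant quotient `ν∕t` is `ν(GL_N(𝒪))` times the number of such lattices.  ★ J1′ at `S = GL_N(𝒪)` (twisted
invariance: ★ `qsInvolution_mem_glInt`) + the unit-shell reading `inv_mul_mul_apply_mem_glInt_iff_mapGL_dualLatt_eq`, transported along ★ W7-f `glCosetEquivLatt`.
[cite: Kottwitz1986BaseChangeUnits, §1 pp. 239–243] [cite: Rogawski1990, §4.10 (4.10.1) p. 57] -/
theorem epsOrbitalIntegral_indicator_glInt_eq_mul_ncard_twistedPolarFixed (hvσ : ∀ a, Valued.v (σ a) = Valued.v a)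
    (hεΘ : ∀ g, ε g = UnitaryGroup.qsInvolution σ g) (hε : Continuous ε) (hK : IsOpen (glInt N K : Set (GL (Fin N) K))) (ht : t Set.univ = 1)
    (hfin : {M : {M : Submodule 𝒪[K] (Fin N → K) // ∃ g : GL (Fin N) K, M = latt (g : Matrix (Fin N) (Fin N) K)} |
        mapGL δ (dualLatt σ ((StdForm.antidiagonal N).over K) M.1) = M.1}.Finite) :
    epsOrbitalIntegral ε δ ((glInt N K : Set (GL (Fin N) K)).indicator (1 : GL (Fin N) K → ℝ)) (quotientMeasure (epsCentralizer ε δ) t hC ν) =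
      (ν (glInt N K)).toReal *
        ({M : {M : Submodule 𝒪[K] (Fin N → K) // ∃ g : GL (Fin N) K, M = latt (g : Matrix (Fin N) (Fin N) K)} |
            mapGL δ (dualLatt σ ((StdForm.antidiagonal N).over K) M.1) = M.1}.ncard : ℝ) := by
  -- twisted `GL_N(𝒪)`-invariance of `S = GL_N(𝒪)`
  have hSK : ∀ k : GL (Fin N) K, k ∈ glInt N K → ∀ g : GL (Fin N) K,
      k * g * (ε k)⁻¹ ∈ (glInt N K : Set (GL (Fin N) K)) ↔ g ∈ (glInt N K : Set (GL (Fin N) K)) := by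
    intro k hk g
    rw [SetLike.mem_coe, SetLike.mem_coe, Subgroup.mul_mem_cancel_right _ ((glInt N K).inv_mem (by rw [hεΘ]; exact qsInvolution_mem_glInt hvσ hk)),
      Subgroup.mul_mem_cancel_left _ hk]
  -- the coset count ↔ the lattice count, along `glCosetEquivLatt`
  have hiff : ∀ q : GL (Fin N) K ⧸ glInt N K,
      q ∈ {q : GL (Fin N) K ⧸ glInt N K | q.out⁻¹ * δ * ε q.out ∈ (glInt N K : Set (GL (Fin N) K))} ↔
        glCosetEquivLatt q ∈ {M : {M : Submodule 𝒪[K] (Fin N → K) // ∃ g : GL (Fin N) K, M = latt (g : Matrix (Fin N) (Fin N) K)} |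
          mapGL δ (dualLatt σ ((StdForm.antidiagonal N).over K) M.1) = M.1} := by
    intro q
    have hq : ((glCosetEquivLatt q : {M : Submodule 𝒪[K] (Fin N → K) // ∃ g : GL (Fin N) K, M = latt (g : Matrix (Fin N) (Fin N) K)}) :
        Submodule 𝒪[K] (Fin N → K)) = latt ((q.out : GL (Fin N) K) : Matrix (Fin N) (Fin N) K) := by
      conv_lhs => rw [← QuotientGroup.out_eq' q]
      exact glCosetEquivLatt_apply_coe q.out
    rw [Set.mem_setOf_eq, Set.mem_setOf_eq, hq]
    exact inv_mul_mul_apply_mem_glInt_iff_mapGL_dualLatt_eq hvσ ε hεΘ δ q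
  have hset : {q : GL (Fin N) K ⧸ glInt N K | q.out⁻¹ * δ * ε q.out ∈ (glInt N K : Set (GL (Fin N) K))} =
      glCosetEquivLatt ⁻¹' {M : {M : Submodule 𝒪[K] (Fin N → K) // ∃ g : GL (Fin N) K, M = latt (g : Matrix (Fin N) (Fin N) K)} |
        mapGL δ (dualLatt σ ((StdForm.antidiagonal N).over K) M.1) = M.1} :=
    Set.ext hiff
  have hfinq : {q : GL (Fin N) K ⧸ glInt N K | q.out⁻¹ * δ * ε q.out ∈ (glInt N K : Set (GL (Fin N) K))}.Finite := by
    rw [hset]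
    exact hfin.preimage glCosetEquivLatt.injective.injOn
  have hncard : {q : GL (Fin N) K ⧸ glInt N K | q.out⁻¹ * δ * ε q.out ∈ (glInt N K : Set (GL (Fin N) K))}.ncard =
      {M : {M : Submodule 𝒪[K] (Fin N → K) // ∃ g : GL (Fin N) K, M = latt (g : Matrix (Fin N) (Fin N) K)} |
        mapGL δ (dualLatt σ ((StdForm.antidiagonal N).over K) M.1) = M.1}.ncard :=
    Set.ncard_congr' (glCosetEquivLatt.subtypeEquiv hiff)
  rw [epsOrbitalIntegral_indicator_quotientMeasure_eq_mul_ncard_shell ε δ (glInt N K) t ν hε hK hSK hK ht hfinq, hncard]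

end Unit

/-! ## §2 `{Λ : δ·Λ^♯ = Λ}` = the `h_δ = J₀·δ⁻¹`-self-dual lattices -/

section SelfDual

variable {K : Type*} [Field K] [Valued K ℤᵐ⁰] {σ : K →+* K} {N : ℕ}

/-- **The fixed lattices of the twisted polarity are the `h_δ`-self-dual lattices**: `{Λ ∈ 𝓛 : δ·Λ^♯ = Λ} = {Λ ∈ 𝓛 : Λ is self-dual for J₀·δ⁻¹}` (★ W9-e₁
`mapGL_dualLatt_eq_dualLatt_mul_inv`: `δ·Λ^♯ = Λ^{♯, J₀δ⁻¹}`; ★ W9-e₂ `dualLatt_latt_eq_self_iff_isSelfDualLattice` for the non-degenerate `J₀·δ⁻¹`; `σ` valuation-preserving,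
`v ϖ ≤ 1`). [cite: Kottwitz1986BaseChangeUnits, §1 p. 242 (C′)] [cite: Jacobowitz1962, §4] -/
theorem setOf_mapGL_dualLatt_eq_self_eq_setOf_isSelfDualLattice (hvσ : ∀ a, Valued.v (σ a) = Valued.v a) {ϖ : K} (hϖ : Valued.v ϖ ≤ 1) (δ : GL (Fin N) K) :
    {M : {M : Submodule 𝒪[K] (Fin N → K) // ∃ g : GL (Fin N) K, M = latt (g : Matrix (Fin N) (Fin N) K)} |
        mapGL δ (dualLatt σ ((StdForm.antidiagonal N).over K) M.1) = M.1} =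
      {M : {M : Submodule 𝒪[K] (Fin N → K) // ∃ g : GL (Fin N) K, M = latt (g : Matrix (Fin N) (Fin N) K)} |
        IsSelfDualLattice σ ϖ ((StdForm.antidiagonal N).over K * (((δ⁻¹ : GL (Fin N) K)) : Matrix (Fin N) (Fin N) K)) M.1} := by
  have hH : IsUnit ((StdForm.antidiagonal N).over K * (((δ⁻¹ : GL (Fin N) K)) : Matrix (Fin N) (Fin N) K)).det := by
    rw [Matrix.det_mul]
    exact ((Matrix.isUnit_iff_isUnit_det _).1 ((StdForm.antidiagonal N).isUnit_over K)).mul (Matrix.isUnits_det_units _)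
  ext M
  obtain ⟨g, hg⟩ := M.2
  rw [Set.mem_setOf_eq, Set.mem_setOf_eq, mapGL_dualLatt_eq_dualLatt_mul_inv, hg, dualLatt_latt_eq_self_iff_isSelfDualLattice hvσ hϖ hH g]

variable [ValuativeRel K] [(Valued.v : Valuation K ℤᵐ⁰).Compatible]
  [LocallyCompactSpace (GL (Fin N) K)] [SecondCountableTopology (GL (Fin N) K)] [T2Space (GL (Fin N) K)]
  [MeasurableSpace (GL (Fin N) K)] [BorelSpace (GL (Fin N) K)]
  (ε : GL (Fin N) K →* GL (Fin N) K) (δ : GL (Fin N) K)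
  [MeasurableSpace (GL (Fin N) K ⧸ epsCentralizer ε δ)] [BorelSpace (GL (Fin N) K ⧸ epsCentralizer ε δ)]
  [hC : IsClosed ((epsCentralizer ε δ : Subgroup (GL (Fin N) K)) : Set (GL (Fin N) K))]
  (t : Measure (epsCentralizer ε δ)) [t.IsMulLeftInvariant]
  [IsFiniteMeasureOnCompacts t] [t.IsOpenPosMeasure] [t.IsInvInvariant] [SFinite t]
  (ν : Measure (GL (Fin N) K)) [IsHaarMeasure ν] [ν.IsMulRightInvariant]
  [CompactSpace (epsCentralizer ε δ)]

/-- **K1 §2 — `Φ_ε(δ, 1_{GL_N(𝒪)}; ν∕t) = ν(GL_N(𝒪)) · #{h_δ-self-dual framed lattices}`, `h_δ = J₀·δ⁻¹`** — the lattice side of Kottwitz's unit identity [Kt₁]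
«`TO_{δσ}(1_{K_E}) = #(h_δ-self-dual lattices) · vol`» (§1 rewritten by `setOf_mapGL_dualLatt_eq_self_eq_setOf_isSelfDualLattice`; `hfin` on the self-dual set).  The matching with
the `U`-side `Σ_{γ′ ∼_st γ} O_{γ′}(1_{K})` (row E1.4.3.3.2, second half) is not here. [cite: Kottwitz1986BaseChangeUnits, §1 pp. 239–243] [cite: Rogawski1990, §4.11 Prop. 4.11.1] -/
theorem epsOrbitalIntegral_indicator_glInt_eq_mul_ncard_isSelfDualLattice (hvσ : ∀ a, Valued.v (σ a) = Valued.v a) {ϖ : K} (hϖ : Valued.v ϖ ≤ 1)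
    (hεΘ : ∀ g, ε g = UnitaryGroup.qsInvolution σ g) (hε : Continuous ε) (hK : IsOpen (glInt N K : Set (GL (Fin N) K))) (ht : t Set.univ = 1)
    (hfin : {M : {M : Submodule 𝒪[K] (Fin N → K) // ∃ g : GL (Fin N) K, M = latt (g : Matrix (Fin N) (Fin N) K)} |
        IsSelfDualLattice σ ϖ ((StdForm.antidiagonal N).over K * (((δ⁻¹ : GL (Fin N) K)) : Matrix (Fin N) (Fin N) K)) M.1}.Finite) :
    epsOrbitalIntegral ε δ ((glInt N K : Set (GL (Fin N) K)).indicator (1 : GL (Fin N) K → ℝ)) (quotientMeasure (epsCentralizer ε δ) t hC ν) =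
      (ν (glInt N K)).toReal *
        ({M : {M : Submodule 𝒪[K] (Fin N → K) // ∃ g : GL (Fin N) K, M = latt (g : Matrix (Fin N) (Fin N) K)} |
            IsSelfDualLattice σ ϖ ((StdForm.antidiagonal N).over K * (((δ⁻¹ : GL (Fin N) K)) : Matrix (Fin N) (Fin N) K)) M.1}.ncard : ℝ) := by
  rw [← setOf_mapGL_dualLatt_eq_self_eq_setOf_isSelfDualLattice hvσ hϖ δ] at hfin ⊢
  exact epsOrbitalIntegral_indicator_glInt_eq_mul_ncard_twistedPolarFixed ε δ t ν hvσ hεΘ hε hK ht hfin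

end SelfDual

/-! ## §3 Conditional transport: `h_δ`-self-dual lattices ↦ `J₀`-self-dual lattices along a frame `g₀` of `h_δ` -/

section Transport

variable {K : Type*} [Field K] [Valued K ℤᵐ⁰] {σ : K →+* K} {ϖ : K} {N : ℕ}

/-- **K1 §3 — CONDITIONAL TRANSPORT TO THE STANDARD SELF-DUAL LATTICES.**  If `h_δ = J₀·δ⁻¹` is the Gram matrix of `J₀` in a frame `g₀ ∈ GL_N(K)`
(`hg₀ : ᵗ(σg₀) J₀ g₀ = J₀·δ⁻¹`, i.e. `formCongr σ g₀ J₀ = J₀ * ↑δ⁻¹` — for an ε-symmetric `δ` of trivial norm class at an inert unramified place such a `g₀` EXISTS by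
Jacobowitz's one-class theorem and the ★ W9-f∕W9-g descent; that existence is NOT proved here), then `Λ ↦ g₀·Λ` is a bijection from the `h_δ`-self-dual framed lattices onto
the `J₀`-self-dual ones (★ `isSelfDualLattice_formCongr_iff`, ★ `mapGL_latt`), so `#{h_δ-self-dual} = #{J₀-self-dual}` (`Set.ncard`).
[cite: Jacobowitz1962, §7] [cite: Kottwitz1986BaseChangeUnits, §1 p. 242; §3 pp. 246–248] -/
theorem ncard_isSelfDualLattice_mul_inv_eq_of_formCongr (δ g₀ : GL (Fin N) K)
    (hg₀ : formCongr σ g₀ ((StdForm.antidiagonal N).over K) = (StdForm.antidiagonal N).over K * (((δ⁻¹ : GL (Fin N) K)) : Matrix (Fin N) (Fin N) K)) :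
    {M : {M : Submodule 𝒪[K] (Fin N → K) // ∃ g : GL (Fin N) K, M = latt (g : Matrix (Fin N) (Fin N) K)} |
        IsSelfDualLattice σ ϖ ((StdForm.antidiagonal N).over K * (((δ⁻¹ : GL (Fin N) K)) : Matrix (Fin N) (Fin N) K)) M.1}.ncard =
      {M : {M : Submodule 𝒪[K] (Fin N → K) // ∃ g : GL (Fin N) K, M = latt (g : Matrix (Fin N) (Fin N) K)} |
        IsSelfDualLattice σ ϖ ((StdForm.antidiagonal N).over K) M.1}.ncard := by
  -- the bijection `M ↦ g₀·M` of framed lattices (inverse `M ↦ g₀⁻¹·M`)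
  let e : {M : Submodule 𝒪[K] (Fin N → K) // ∃ g : GL (Fin N) K, M = latt (g : Matrix (Fin N) (Fin N) K)} ≃
      {M : Submodule 𝒪[K] (Fin N → K) // ∃ g : GL (Fin N) K, M = latt (g : Matrix (Fin N) (Fin N) K)} :=
    { toFun := fun M => ⟨mapGL g₀ M.1, by obtain ⟨g, hg⟩ := M.2; exact ⟨g₀ * g, by rw [hg, mapGL_latt]⟩⟩
      invFun := fun M => ⟨mapGL g₀⁻¹ M.1, by obtain ⟨g, hg⟩ := M.2; exact ⟨g₀⁻¹ * g, by rw [hg, mapGL_latt]⟩⟩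
      left_inv := fun M => Subtype.ext (mapGL_inv_mapGL g₀ M.1)
      right_inv := fun M => Subtype.ext (mapGL_mapGL_inv g₀ M.1) }
  refine Set.ncard_congr' (e.subtypeEquiv fun M => ?_)
  change IsSelfDualLattice σ ϖ ((StdForm.antidiagonal N).over K * (((δ⁻¹ : GL (Fin N) K)) : Matrix (Fin N) (Fin N) K)) M.1 ↔
    IsSelfDualLattice σ ϖ ((StdForm.antidiagonal N).over K) (mapGL g₀ M.1)
  rw [← hg₀, isSelfDualLattice_formCongr_iff]

end Transport

end Summit.HodgeConjecture.HodgeConjecture.R90.S6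

end
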